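import Summits.NavierStokesRegularity.NavierStokesRegularity.Theorems.StrainDoorsNearFieldKernel
import Literature.Analysis.FluidPDE.WholeSpaceDivCurlIdentity
import Mathlib.Analysis.Calculus.LineDeriv.IntegrationByParts
import HarnessLib

/-!
# StrainDoorsNearFieldFarIBP — atom A2♭ «FarFieldEnergyBound», the double integration by parts:
# `farQuadS_r = −∫ D²[(1−χ_r)K_e](z−x)(u, u) dz` for a smooth divergence-free slice with `u, ∇u, ∇²u ∈ L²`

ROUND-43/44 door D7♭ (`Theorems/StrainDoorsNearFieldDefs`, nsreg-p1 g33). With `G = farKernel r e` (kernel half: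
`Theorems/StrainDoorsNearFieldKernel`) and `v = u(t)` smooth and divergence free, the Q-density is a double divergence,
`f = ½|ω|² − |S|² = |curl v|² − |∇v|²_F = −div((v·∇)v)` (tree `frobeniusNormSq_sub_norm_curl_sq_eq_divergence`) and
`((v·∇)v)ᵢ = Σⱼ ∂ⱼ(vⱼvᵢ)` (`div v = 0` again), so two integrations by parts on the whole space (Mathlib
`integral_mul_fderiv_eq_neg_fderiv_mul_of_integrable`: integrable products, no boundary terms) move both derivatives
onto the bounded smooth kernel:

  `farQuadS r u t x e = −Σᵢⱼ ∫ ∂ⱼ∂ᵢG(z − x) · vⱼ(z) vᵢ(z) dz`   (`farQuadS_eq_neg_sum_integral_hessian_mul`).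

Hypotheses on the slice: `ContDiff ℝ ∞ v`, `IsDivFree v`, and `‖v‖², ‖∇v‖², ‖∇²v‖²` integrable (all supplied by the
door frame). Everything proved; no named facts; `--supports stmt-NavierStokesRegularity-0056 --as helper` (ns-s29-p2 g5;
LEAD S-door ns-s30-p1 g4 key «A2♭»). [folklore: Constantin 2014 arXiv:1309.5789 §5 (β bounded by ‖u‖_{L²}), one Hessian up.]

HONEST FRAME: calculus for one true analytic atom (A2♭) of a CONDITIONAL regularity criterion (D7♭); items 0056
`NoTypeII`, 10661 and NS regularity are NOT proved; nothing here is a route or a summit statement.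
-/

noncomputable section

open MeasureTheory Set Function Filter Metric Real InnerProductSpace
open _root_.Topology
open scoped RealInnerProductSpace ContDiff
open Literature.Analysis Literature.Analysis.FluidPDE

set_option linter.dupNamespace false

namespace Summit.NavierStokesRegularity.NavierStokesRegularity.Theorems.StrainDoors

/-! ## §1 Pointwise identities for a smooth divergence-free field -/

/-- the Q-density is minus a divergence: `½|ω|² − |S|² = −div((v·∇)v)` for `v = u(t)` smooth and divergence free. -/
theorem qDensity_eq_neg_divergence_convect {u : ℝ → (EuclideanSpace ℝ (Fin 3)) → (EuclideanSpace ℝ (Fin 3))} {t : ℝ}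
    (hv : ContDiff ℝ ∞ (u t)) (hdiv : VectorCalculus.IsDivFree (u t)) (z : EuclideanSpace ℝ (Fin 3)) :
    qDensity u t z = -VectorCalculus.divergence (convect (u t) (u t)) z := by
  have h := frobeniusNormSq_sub_norm_curl_sq_eq_divergence hv hdiv z
  unfold qDensity strainNormSq
  linarith

/-- the `i`-th component `z ↦ ⟪w z, bᵢ⟫` of a differentiable field has derivative `⟪Dw(z) h, bᵢ⟫`. -/
theorem fderiv_inner_const_apply {w : EuclideanSpace ℝ (Fin 3) → EuclideanSpace ℝ (Fin 3)} {z : EuclideanSpace ℝ (Fin 3)}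
    (hw : DifferentiableAt ℝ w z) (c h : EuclideanSpace ℝ (Fin 3)) :
    fderiv ℝ (fun z => ⟪w z, c⟫) z h = ⟪fderiv ℝ w z h, c⟫ := by
  rw [fderiv_inner_apply ℝ hw (differentiableAt_const c)]
  simp

/-- the divergence as the sum of the coordinate derivatives of the components along an orthonormal basis. -/
theorem divergence_eq_sum_fderiv_inner {ι : Type*} [Fintype ι] (b : OrthonormalBasis ι ℝ (EuclideanSpace ℝ (Fin 3)))
    {w : EuclideanSpace ℝ (Fin 3) → EuclideanSpace ℝ (Fin 3)} {z : EuclideanSpace ℝ (Fin 3)} (hw : DifferentiableAt ℝ w z) :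
    VectorCalculus.divergence w z = ∑ i, fderiv ℝ (fun z => ⟪w z, b i⟫) z (b i) := by
  rw [divergence_eq_sum_inner_fderiv b]
  exact Finset.sum_congr rfl fun i _ => by rw [fderiv_inner_const_apply hw, real_inner_comm]

/-- **`((v·∇)v)ᵢ = Σⱼ ∂ⱼ(vⱼ vᵢ)`** for a differentiable divergence-free field (components along an orthonormal basis). -/
theorem inner_convect_eq_sum_fderiv_mul {ι : Type*} [Fintype ι] (b : OrthonormalBasis ι ℝ (EuclideanSpace ℝ (Fin 3)))
    {v : EuclideanSpace ℝ (Fin 3) → EuclideanSpace ℝ (Fin 3)} {z : EuclideanSpace ℝ (Fin 3)}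
    (hv : DifferentiableAt ℝ v z) (hdiv : VectorCalculus.divergence v z = 0) (i : ι) :
    ⟪convect v v z, b i⟫ = ∑ j, fderiv ℝ (fun z => ⟪v z, b j⟫ * ⟪v z, b i⟫) z (b j) := by
  have hcomp : ∀ k, DifferentiableAt ℝ (fun z => ⟪v z, b k⟫) z := fun k =>
    (hv.inner ℝ (differentiableAt_const _))
  have hprod : ∀ j, fderiv ℝ (fun z => ⟪v z, b j⟫ * ⟪v z, b i⟫) z (b j) =
      ⟪fderiv ℝ v z (b j), b j⟫ * ⟪v z, b i⟫ + ⟪v z, b j⟫ * ⟪fderiv ℝ v z (b j), b i⟫ := fun j => by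
    rw [fderiv_fun_mul (hcomp j) (hcomp i)]
    simp only [_root_.add_apply, FunLike.coe_smul, Pi.smul_apply, smul_eq_mul,
      fderiv_inner_const_apply hv]
    ring
  simp_rw [hprod, Finset.sum_add_distrib]
  -- the first sum is `(div v) vᵢ = 0`
  have h1 : ∑ j, ⟪fderiv ℝ v z (b j), b j⟫ * ⟪v z, b i⟫ = 0 := by
    rw [← Finset.sum_mul]
    have : ∑ j, ⟪fderiv ℝ v z (b j), b j⟫ = VectorCalculus.divergence v z := by
      rw [divergence_eq_sum_inner_fderiv b]
      exact Finset.sum_congr rfl fun j _ => real_inner_comm _ _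
    rw [this, hdiv, zero_mul]
  -- the second is `⟪Dv(z) v(z), bᵢ⟫`
  have h2 : ∑ j, ⟪v z, b j⟫ * ⟪fderiv ℝ v z (b j), b i⟫ = ⟪fderiv ℝ v z (v z), b i⟫ := by
    conv_rhs => rw [← b.sum_repr' (v z)]
    rw [map_sum, sum_inner]
    refine Finset.sum_congr rfl fun j _ => ?_
    rw [map_smul, real_inner_smul_left, real_inner_comm (b j)]
  rw [h1, h2, zero_add, convect]

/-! ## §2 Translation to the `z = x + y` variable -/

/-- `farQuadS` with the kernel translated instead of the field: `∫ G(y) f(x+y) dy = ∫ G(z−x) f(z) dz`. -/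
theorem farQuadS_eq_integral_sub (r : ℝ) (u : ℝ → (EuclideanSpace ℝ (Fin 3)) → (EuclideanSpace ℝ (Fin 3))) (t : ℝ)
    (x e : EuclideanSpace ℝ (Fin 3)) :
    farQuadS r u t x e = ∫ z, farKernel r e (z - x) * qDensity u t z := by
  rw [farQuadS_eq_integral_farKernel,
    ← integral_add_right_eq_self (fun z => farKernel r e (z - x) * qDensity u t z) x]
  refine integral_congr_ae (Eventually.of_forall fun y => ?_)
  simp [add_sub_cancel_right, add_comm x y]

/-! ## §3 Integrability bookkeeping -/

section Integrability

variable {v : EuclideanSpace ℝ (Fin 3) → EuclideanSpace ℝ (Fin 3)}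

/-- a continuous function dominated by an integrable one is integrable. -/
theorem integrable_of_continuous_of_le {f g : EuclideanSpace ℝ (Fin 3) → ℝ} (hf : Continuous f) (hg : Integrable g)
    (h : ∀ z, |f z| ≤ g z) : Integrable f :=
  Integrable.mono' hg hf.aestronglyMeasurable (Eventually.of_forall fun z => by simpa [Real.norm_eq_abs] using h z)

/-- products of components are integrable: `|vⱼ vᵢ| ≤ ‖v‖²`. -/
theorem integrable_inner_mul_inner (hvc : Continuous v) (hL2 : Integrable fun z => ‖v z‖ ^ 2)
    (c d : EuclideanSpace ℝ (Fin 3)) (hc : ‖c‖ = 1) (hd : ‖d‖ = 1) :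
    Integrable fun z => ⟪v z, c⟫ * ⟪v z, d⟫ := by
  refine integrable_of_continuous_of_le ((hvc.inner continuous_const).mul (hvc.inner continuous_const)) hL2 fun z => ?_
  rw [abs_mul]
  have h1 : |⟪v z, c⟫| ≤ ‖v z‖ := by simpa [hc] using abs_real_inner_le_norm (v z) c
  have h2 : |⟪v z, d⟫| ≤ ‖v z‖ := by simpa [hd] using abs_real_inner_le_norm (v z) d
  calc |⟪v z, c⟫| * |⟪v z, d⟫| ≤ ‖v z‖ * ‖v z‖ := mul_le_mul h1 h2 (abs_nonneg _) (norm_nonneg _)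
    _ = ‖v z‖ ^ 2 := (sq _).symm

/-- the derivative of a product of components is integrable: `|∂ₕ(vⱼvᵢ)| ≤ 2‖Dv‖‖v‖ ≤ ‖Dv‖² + ‖v‖²`. -/
theorem integrable_fderiv_inner_mul_inner (hv : ContDiff ℝ 1 v) (hL2 : Integrable fun z => ‖v z‖ ^ 2)
    (hD : Integrable fun z => ‖fderiv ℝ v z‖ ^ 2) (c d h : EuclideanSpace ℝ (Fin 3)) (hc : ‖c‖ = 1) (hd : ‖d‖ = 1)
    (hh : ‖h‖ = 1) :
    Integrable fun z => fderiv ℝ (fun z => ⟪v z, c⟫ * ⟪v z, d⟫) z h := by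
  have hvd : ∀ z, DifferentiableAt ℝ v z := fun z => (hv.differentiable one_ne_zero) z
  have hcomp : ∀ k z, DifferentiableAt ℝ (fun z => ⟪v z, k⟫) z := fun k z => (hvd z).inner ℝ (differentiableAt_const _)
  have hform : (fun z => fderiv ℝ (fun z => ⟪v z, c⟫ * ⟪v z, d⟫) z h) =
      fun z => ⟪fderiv ℝ v z h, c⟫ * ⟪v z, d⟫ + ⟪v z, c⟫ * ⟪fderiv ℝ v z h, d⟫ := by
    funext z
    rw [fderiv_fun_mul (hcomp c z) (hcomp d z)]
    simp only [_root_.add_apply, FunLike.coe_smul, Pi.smul_apply, smul_eq_mul, fderiv_inner_const_apply (hvd z)]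
    ring
  rw [hform]
  have hvc : Continuous v := hv.continuous
  have hDc : Continuous (fderiv ℝ v) := hv.continuous_fderiv one_ne_zero
  refine integrable_of_continuous_of_le ?_ (hD.add hL2) fun z => ?_
  · exact (((hDc.clm_apply continuous_const).inner continuous_const).mul (hvc.inner continuous_const)).add
      ((hvc.inner continuous_const).mul ((hDc.clm_apply continuous_const).inner continuous_const))
  · have ha : |⟪fderiv ℝ v z h, c⟫| ≤ ‖fderiv ℝ v z‖ := by
      have := abs_real_inner_le_norm (fderiv ℝ v z h) c
      rw [hc, mul_one] at this
      exact this.trans ((ContinuousLinearMap.le_opNorm _ _).trans (by rw [hh, mul_one]))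
    have hb : |⟪fderiv ℝ v z h, d⟫| ≤ ‖fderiv ℝ v z‖ := by
      have := abs_real_inner_le_norm (fderiv ℝ v z h) d
      rw [hd, mul_one] at this
      exact this.trans ((ContinuousLinearMap.le_opNorm _ _).trans (by rw [hh, mul_one]))
    have hc' : |⟪v z, c⟫| ≤ ‖v z‖ := by simpa [hc] using abs_real_inner_le_norm (v z) c
    have hd' : |⟪v z, d⟫| ≤ ‖v z‖ := by simpa [hd] using abs_real_inner_le_norm (v z) d
    calc |⟪fderiv ℝ v z h, c⟫ * ⟪v z, d⟫ + ⟪v z, c⟫ * ⟪fderiv ℝ v z h, d⟫|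
        ≤ |⟪fderiv ℝ v z h, c⟫| * |⟪v z, d⟫| + |⟪v z, c⟫| * |⟪fderiv ℝ v z h, d⟫| := by
          rw [← abs_mul, ← abs_mul]
          exact abs_add_le _ _
      _ ≤ ‖fderiv ℝ v z‖ * ‖v z‖ + ‖v z‖ * ‖fderiv ℝ v z‖ := by
          gcongr
      _ ≤ ‖fderiv ℝ v z‖ ^ 2 + ‖v z‖ ^ 2 := by nlinarith [sq_nonneg (‖fderiv ℝ v z‖ - ‖v z‖)]

/-- the component of the convective term is integrable: `|⟪(v·∇)v, bᵢ⟫| ≤ ‖Dv‖‖v‖`. -/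
theorem integrable_inner_convect (hv : ContDiff ℝ 1 v) (hL2 : Integrable fun z => ‖v z‖ ^ 2)
    (hD : Integrable fun z => ‖fderiv ℝ v z‖ ^ 2) (c : EuclideanSpace ℝ (Fin 3)) (hc : ‖c‖ = 1) :
    Integrable fun z => ⟪convect v v z, c⟫ := by
  have hvc : Continuous v := hv.continuous
  have hDc : Continuous (fderiv ℝ v) := hv.continuous_fderiv one_ne_zero
  have hg : Integrable (fun z => (‖fderiv ℝ v z‖ ^ 2 + ‖v z‖ ^ 2) / 2) := (hD.add hL2).div_const 2
  refine integrable_of_continuous_of_le ((hDc.clm_apply hvc).inner continuous_const) hg fun z => ?_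
  have h1 : |⟪convect v v z, c⟫| ≤ ‖fderiv ℝ v z‖ * ‖v z‖ := by
    have := abs_real_inner_le_norm (convect v v z) c
    rw [hc, mul_one] at this
    exact this.trans (ContinuousLinearMap.le_opNorm _ _)
  refine h1.trans ?_
  rw [le_div_iff₀ (by norm_num : (0:ℝ) < 2)]
  nlinarith [sq_nonneg (‖fderiv ℝ v z‖ - ‖v z‖)]

/-- the coordinate derivative of the component of the convective term is integrable:
`∂ₕ⟪Dv(z)v(z), c⟫ = ⟪D²v(z)(h, v z) + Dv(z)(Dv(z)h), c⟫`, `|·| ≤ ‖D²v‖‖v‖ + ‖Dv‖²`. -/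
theorem integrable_fderiv_inner_convect (hv : ContDiff ℝ 2 v) (hL2 : Integrable fun z => ‖v z‖ ^ 2)
    (hD : Integrable fun z => ‖fderiv ℝ v z‖ ^ 2) (hD2 : Integrable fun z => ‖iteratedFDeriv ℝ 2 v z‖ ^ 2)
    (c h : EuclideanSpace ℝ (Fin 3)) (hc : ‖c‖ = 1) (hh : ‖h‖ = 1) :
    Integrable fun z => fderiv ℝ (fun z => ⟪convect v v z, c⟫) z h := by
  have hv1 : ContDiff ℝ 1 v := hv.of_le one_le_two
  have hvd : ∀ z, DifferentiableAt ℝ v z := fun z => (hv1.differentiable one_ne_zero) z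
  have hDd : ∀ z, DifferentiableAt ℝ (fderiv ℝ v) z := fun z =>
    ((hv.fderiv_right (m := 1) le_rfl).differentiable one_ne_zero) z
  have hWd : ∀ z, HasFDerivAt (convect v v) ((fderiv ℝ v z).comp (fderiv ℝ v z) + (fderiv ℝ (fderiv ℝ v) z).flip (v z)) z :=
    fun z => (hDd z).hasFDerivAt.clm_apply (hvd z).hasFDerivAt
  have hform : (fun z => fderiv ℝ (fun z => ⟪convect v v z, c⟫) z h) =
      fun z => ⟪(fderiv ℝ v z) (fderiv ℝ v z h) + (fderiv ℝ (fderiv ℝ v) z h) (v z), c⟫ := by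
    funext z
    rw [fderiv_inner_const_apply (hWd z).differentiableAt, (hWd z).fderiv]
    simp
  rw [hform]
  have hvc : Continuous v := hv.continuous
  have hDc : Continuous (fderiv ℝ v) := hv1.continuous_fderiv one_ne_zero
  have hD2c : Continuous (fderiv ℝ (fderiv ℝ v)) :=
    (hv.fderiv_right (m := 1) le_rfl).continuous_fderiv one_ne_zero
  have hg : Integrable (fun z => (‖iteratedFDeriv ℝ 2 v z‖ ^ 2 + ‖v z‖ ^ 2) / 2 + ‖fderiv ℝ v z‖ ^ 2) :=
    ((hD2.add hL2).div_const 2).add hD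
  refine integrable_of_continuous_of_le ?_ hg fun z => ?_
  · exact (((hDc.clm_apply (hDc.clm_apply continuous_const)).add
      ((hD2c.clm_apply continuous_const).clm_apply hvc)).inner continuous_const)
  · have h1 : |⟪(fderiv ℝ v z) (fderiv ℝ v z h) + (fderiv ℝ (fderiv ℝ v) z h) (v z), c⟫| ≤
        ‖(fderiv ℝ v z) (fderiv ℝ v z h) + (fderiv ℝ (fderiv ℝ v) z h) (v z)‖ := by
      have := abs_real_inner_le_norm ((fderiv ℝ v z) (fderiv ℝ v z h) + (fderiv ℝ (fderiv ℝ v) z h) (v z)) c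
      rwa [hc, mul_one] at this
    have h2 : ‖(fderiv ℝ v z) (fderiv ℝ v z h)‖ ≤ ‖fderiv ℝ v z‖ ^ 2 := by
      calc ‖(fderiv ℝ v z) (fderiv ℝ v z h)‖ ≤ ‖fderiv ℝ v z‖ * ‖fderiv ℝ v z h‖ := ContinuousLinearMap.le_opNorm _ _
        _ ≤ ‖fderiv ℝ v z‖ * (‖fderiv ℝ v z‖ * ‖h‖) := by gcongr; exact ContinuousLinearMap.le_opNorm _ _
        _ = ‖fderiv ℝ v z‖ ^ 2 := by rw [hh, mul_one, sq]
    have h3 : ‖(fderiv ℝ (fderiv ℝ v) z h) (v z)‖ ≤ ‖iteratedFDeriv ℝ 2 v z‖ * ‖v z‖ := by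
      calc ‖(fderiv ℝ (fderiv ℝ v) z h) (v z)‖ ≤ ‖fderiv ℝ (fderiv ℝ v) z h‖ * ‖v z‖ := ContinuousLinearMap.le_opNorm _ _
        _ ≤ (‖fderiv ℝ (fderiv ℝ v) z‖ * ‖h‖) * ‖v z‖ := by gcongr; exact ContinuousLinearMap.le_opNorm _ _
        _ = ‖iteratedFDeriv ℝ 2 v z‖ * ‖v z‖ := by
          rw [hh, mul_one, ← norm_iteratedFDeriv_fderiv, ← norm_iteratedFDeriv_fderiv, norm_iteratedFDeriv_zero]
    calc |⟪(fderiv ℝ v z) (fderiv ℝ v z h) + (fderiv ℝ (fderiv ℝ v) z h) (v z), c⟫|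
        ≤ ‖fderiv ℝ v z‖ ^ 2 + ‖iteratedFDeriv ℝ 2 v z‖ * ‖v z‖ :=
          h1.trans ((norm_add_le _ _).trans (add_le_add h2 h3))
      _ ≤ (‖iteratedFDeriv ℝ 2 v z‖ ^ 2 + ‖v z‖ ^ 2) / 2 + ‖fderiv ℝ v z‖ ^ 2 := by
          nlinarith [sq_nonneg (‖iteratedFDeriv ℝ 2 v z‖ - ‖v z‖)]

end Integrability

/-! ## §4 The shifted kernel and the double integration by parts -/

/-- the kernel shifted by `x` is `C²` (indeed smooth). -/
theorem contDiff_farKernel_sub {r : ℝ} (hr : 0 < r) (e x : EuclideanSpace ℝ (Fin 3)) :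
    ContDiff ℝ 2 (fun z => farKernel r e (z - x)) :=
  (contDiff_farKernel (n := 2) hr e).comp (contDiff_id.sub contDiff_const)

/-- mixed second coordinate derivative of the shifted kernel versus its Hessian norm:
`|∂ⱼ∂ᵢG(z)| ≤ ‖D²(farKernel r e)(z − x)‖` for unit `bᵢ, bⱼ`. -/
theorem abs_fderiv_fderiv_farKernel_sub_le {r : ℝ} (hr : 0 < r) (e x z h k : EuclideanSpace ℝ (Fin 3)) (hh : ‖h‖ = 1)
    (hk : ‖k‖ = 1) :
    |fderiv ℝ (fun z => fderiv ℝ (fun z => farKernel r e (z - x)) z h) z k| ≤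
      ‖iteratedFDeriv ℝ 2 (farKernel r e) (z - x)‖ := by
  set G := fun z => farKernel r e (z - x) with hG
  have hG2 : ContDiff ℝ 2 G := contDiff_farKernel_sub hr e x
  have hDd : DifferentiableAt ℝ (fderiv ℝ G) z :=
    ((hG2.fderiv_right (m := 1) le_rfl).differentiable one_ne_zero) z
  have h1 : fderiv ℝ (fun z => fderiv ℝ G z h) z k = fderiv ℝ (fderiv ℝ G) z k h := by
    rw [fderiv_clm_apply hDd (differentiableAt_const h)]
    simp
  rw [h1]
  have h2 : ‖iteratedFDeriv ℝ 2 (farKernel r e) (z - x)‖ = ‖fderiv ℝ (fderiv ℝ G) z‖ := by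
    rw [hG, ← iteratedFDeriv_comp_sub, ← norm_iteratedFDeriv_fderiv, ← norm_iteratedFDeriv_fderiv,
      norm_iteratedFDeriv_zero]
  rw [h2, ← Real.norm_eq_abs]
  calc ‖fderiv ℝ (fderiv ℝ G) z k h‖ ≤ ‖fderiv ℝ (fderiv ℝ G) z k‖ * ‖h‖ := ContinuousLinearMap.le_opNorm _ _
    _ ≤ ‖fderiv ℝ (fderiv ℝ G) z‖ * ‖k‖ * ‖h‖ := by gcongr; exact ContinuousLinearMap.le_opNorm _ _
    _ = ‖fderiv ℝ (fderiv ℝ G) z‖ := by rw [hh, hk, mul_one, mul_one]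

/-- first coordinate derivative of the shifted kernel versus its gradient norm. -/
theorem abs_fderiv_farKernel_sub_le {r : ℝ} (e x z h : EuclideanSpace ℝ (Fin 3)) (hh : ‖h‖ = 1) :
    |fderiv ℝ (fun z => farKernel r e (z - x)) z h| ≤ ‖iteratedFDeriv ℝ 1 (farKernel r e) (z - x)‖ := by
  rw [← iteratedFDeriv_comp_sub, norm_iteratedFDeriv_one, ← Real.norm_eq_abs]
  calc ‖fderiv ℝ (fun z => farKernel r e (z - x)) z h‖ ≤ ‖fderiv ℝ (fun z => farKernel r e (z - x)) z‖ * ‖h‖ :=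
        ContinuousLinearMap.le_opNorm _ _
    _ = ‖fderiv ℝ (fun z => farKernel r e (z - x)) z‖ := by rw [hh, mul_one]

/-- bounded continuous factor times integrable factor is integrable. -/
theorem integrable_bdd_mul_of_continuous {φ ψ : EuclideanSpace ℝ (Fin 3) → ℝ} (hφ : Continuous φ) {M : ℝ}
    (hM : ∀ z, |φ z| ≤ M) (hψ : Integrable ψ) : Integrable fun z => φ z * ψ z :=
  hψ.bdd_mul hφ.aestronglyMeasurable (Eventually.of_forall fun z => by simpa [Real.norm_eq_abs] using hM z)

/-- ★ **THE DOUBLE INTEGRATION BY PARTS** (A2♭ identity): for `v = u(t)` smooth and divergence free with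
`‖v‖², ‖∇v‖², ‖∇²v‖²` integrable, `r > 0` and a unit `e`,
`farQuadS r u t x e = −Σᵢⱼ ∫ ∂ⱼ∂ᵢ[farKernel r e(· − x)](z) · ⟪v z, bⱼ⟫⟪v z, bᵢ⟫ dz` (standard basis `b`). -/
theorem farQuadS_eq_neg_sum_integral_hessian_mul {r : ℝ} (hr : 0 < r) {e : EuclideanSpace ℝ (Fin 3)} (he : ‖e‖ = 1)
    {u : ℝ → (EuclideanSpace ℝ (Fin 3)) → (EuclideanSpace ℝ (Fin 3))} {t : ℝ} (hv : ContDiff ℝ ∞ (u t))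
    (hdiv : VectorCalculus.IsDivFree (u t)) (hL2 : Integrable fun z => ‖u t z‖ ^ 2)
    (hD : Integrable fun z => ‖fderiv ℝ (u t) z‖ ^ 2) (hD2 : Integrable fun z => ‖iteratedFDeriv ℝ 2 (u t) z‖ ^ 2)
    (x : EuclideanSpace ℝ (Fin 3)) :
    farQuadS r u t x e = -∑ i, ∑ j, ∫ z,
      fderiv ℝ (fun z => fderiv ℝ (fun z => farKernel r e (z - x)) z (EuclideanSpace.basisFun (Fin 3) ℝ i)) z
          (EuclideanSpace.basisFun (Fin 3) ℝ j) *
        (⟪u t z, EuclideanSpace.basisFun (Fin 3) ℝ j⟫ * ⟪u t z, EuclideanSpace.basisFun (Fin 3) ℝ i⟫) := by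
  set b := EuclideanSpace.basisFun (Fin 3) ℝ with hb
  set v := u t with hvdef
  set G : EuclideanSpace ℝ (Fin 3) → ℝ := fun z => farKernel r e (z - x) with hG
  have hb1 : ∀ i, ‖b i‖ = 1 := fun i => b.orthonormal.1 i
  -- regularity of the field
  have hv2 : ContDiff ℝ 2 v := contDiff_infty.1 hv 2
  have hv1 : ContDiff ℝ 1 v := contDiff_infty.1 hv 1
  have hvd : ∀ z, DifferentiableAt ℝ v z := fun z => (hv1.differentiable one_ne_zero) z
  have hvc : Continuous v := hv.continuous
  -- the kernel: `C²`, bounded with bounded first and second derivatives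
  have hG2 : ContDiff ℝ 2 G := contDiff_farKernel_sub hr e x
  have hG1 : ContDiff ℝ 1 G := hG2.of_le one_le_two
  have hGd : ∀ z, DifferentiableAt ℝ G z := fun z => (hG1.differentiable one_ne_zero) z
  have hGc : Continuous G := hG2.continuous
  have hDGc : ∀ h, Continuous fun z => fderiv ℝ G z h := fun h => (hG1.continuous_fderiv one_ne_zero).clm_apply continuous_const
  have hDGd : ∀ h z, DifferentiableAt ℝ (fun z => fderiv ℝ G z h) z := fun h z =>
    (((hG2.fderiv_right (m := 1) le_rfl).differentiable one_ne_zero) z).clm_apply (differentiableAt_const h)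
  have hDDGc : ∀ h k, Continuous fun z => fderiv ℝ (fun z => fderiv ℝ G z h) z k := fun h k => by
    have hc1 : ContDiff ℝ 1 (fun z => fderiv ℝ G z h) := (hG2.fderiv_right (m := 1) le_rfl).clm_apply contDiff_const
    exact (hc1.continuous_fderiv one_ne_zero).clm_apply continuous_const
  obtain ⟨C₁, -, hC₁⟩ := exists_norm_iteratedFDeriv_farKernel_le (n := 1) (by norm_num)
  obtain ⟨C₂, -, hC₂⟩ := exists_norm_iteratedFDeriv_farKernel_le (n := 2) le_rfl
  have hGb : ∀ z, |G z| ≤ 2 / r ^ 3 := fun z => abs_farKernel_le hr he _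
  have hDGb : ∀ i z, |fderiv ℝ G z (b i)| ≤ C₁ / r ^ (3 + 1) := fun i z =>
    (abs_fderiv_farKernel_sub_le e x z (b i) (hb1 i)).trans (hC₁ r hr e he _)
  have hDDGb : ∀ i j z, |fderiv ℝ (fun z => fderiv ℝ G z (b i)) z (b j)| ≤ C₂ / r ^ (3 + 2) := fun i j z =>
    (abs_fderiv_fderiv_farKernel_sub_le hr e x z (b i) (b j) (hb1 i) (hb1 j)).trans (hC₂ r hr e he _)
  -- the field-side integrable factors
  have hIW : ∀ i, Integrable fun z => ⟪convect v v z, b i⟫ := fun i => integrable_inner_convect hv1 hL2 hD (b i) (hb1 i)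
  have hIdW : ∀ i, Integrable fun z => fderiv ℝ (fun z => ⟪convect v v z, b i⟫) z (b i) := fun i =>
    integrable_fderiv_inner_convect hv2 hL2 hD hD2 (b i) (b i) (hb1 i) (hb1 i)
  have hIP : ∀ i j, Integrable fun z => ⟪v z, b j⟫ * ⟪v z, b i⟫ := fun i j =>
    integrable_inner_mul_inner hvc hL2 (b j) (b i) (hb1 j) (hb1 i)
  have hIdP : ∀ i j, Integrable fun z => fderiv ℝ (fun z => ⟪v z, b j⟫ * ⟪v z, b i⟫) z (b j) := fun i j =>
    integrable_fderiv_inner_mul_inner hv1 hL2 hD (b j) (b i) (b j) (hb1 j) (hb1 i) (hb1 j)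
  -- differentiability of the field-side factors (everywhere)
  have hWd : ∀ i z, DifferentiableAt ℝ (fun z => ⟪convect v v z, b i⟫) z := fun i z => by
    have hDd : DifferentiableAt ℝ (fderiv ℝ v) z := ((hv2.fderiv_right (m := 1) le_rfl).differentiable one_ne_zero) z
    exact ((hDd.clm_apply (hvd z)).inner ℝ (differentiableAt_const _))
  have hPd : ∀ i j z, DifferentiableAt ℝ (fun z => ⟪v z, b j⟫ * ⟪v z, b i⟫) z := fun i j z =>
    ((hvd z).inner ℝ (differentiableAt_const _)).mul ((hvd z).inner ℝ (differentiableAt_const _))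
  -- Step A: `farQuadS = ∫ G · f`, `f = −div((v·∇)v) = −Σᵢ ∂ᵢWᵢ`
  have hA : farQuadS r u t x e = -∑ i, ∫ z, G z * fderiv ℝ (fun z => ⟪convect v v z, b i⟫) z (b i) := by
    rw [farQuadS_eq_integral_sub]
    have hpt : ∀ z, farKernel r e (z - x) * qDensity u t z =
        -∑ i, G z * fderiv ℝ (fun z => ⟪convect v v z, b i⟫) z (b i) := fun z => by
      have hWdz : DifferentiableAt ℝ (convect v v) z :=
        (((hv2.fderiv_right (m := 1) le_rfl).differentiable one_ne_zero) z).clm_apply (hvd z)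
      rw [qDensity_eq_neg_divergence_convect hv hdiv z, ← hvdef,
        divergence_eq_sum_fderiv_inner b (w := convect v v) hWdz, mul_neg, Finset.mul_sum]
    simp_rw [hpt, integral_neg]
    rw [integral_finsetSum _ fun i _ => integrable_bdd_mul_of_continuous hGc hGb (hIdW i)]
  -- Step B: first integration by parts, `∫ G ∂ᵢWᵢ = −∫ ∂ᵢG Wᵢ`
  have hB : ∀ i, ∫ z, G z * fderiv ℝ (fun z => ⟪convect v v z, b i⟫) z (b i) =
      -∫ z, fderiv ℝ G z (b i) * ⟪convect v v z, b i⟫ := fun i =>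
    integral_mul_fderiv_eq_neg_fderiv_mul_of_integrable
      (integrable_bdd_mul_of_continuous (hDGc _) (hDGb i) (hIW i))
      (integrable_bdd_mul_of_continuous hGc hGb (hIdW i))
      (integrable_bdd_mul_of_continuous hGc hGb (hIW i))
      (fun z _ => hGd z) (fun z _ => hWd i z)
  -- Step C: `Wᵢ = Σⱼ ∂ⱼ(vⱼvᵢ)`
  have hC : ∀ i, ∫ z, fderiv ℝ G z (b i) * ⟪convect v v z, b i⟫ =
      ∑ j, ∫ z, fderiv ℝ G z (b i) * fderiv ℝ (fun z => ⟪v z, b j⟫ * ⟪v z, b i⟫) z (b j) := fun i => by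
    have hpt : ∀ z, fderiv ℝ G z (b i) * ⟪convect v v z, b i⟫ =
        ∑ j, fderiv ℝ G z (b i) * fderiv ℝ (fun z => ⟪v z, b j⟫ * ⟪v z, b i⟫) z (b j) := fun z => by
      rw [inner_convect_eq_sum_fderiv_mul b (hvd z) (hdiv z) i, Finset.mul_sum]
    simp_rw [hpt]
    exact integral_finsetSum _ fun j _ => integrable_bdd_mul_of_continuous (hDGc _) (hDGb i) (hIdP i j)
  -- Step D: second integration by parts, `∫ ∂ᵢG ∂ⱼ(vⱼvᵢ) = −∫ ∂ⱼ∂ᵢG vⱼvᵢ`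
  have hDstep : ∀ i j, ∫ z, fderiv ℝ G z (b i) * fderiv ℝ (fun z => ⟪v z, b j⟫ * ⟪v z, b i⟫) z (b j) =
      -∫ z, fderiv ℝ (fun z => fderiv ℝ G z (b i)) z (b j) * (⟪v z, b j⟫ * ⟪v z, b i⟫) := fun i j =>
    integral_mul_fderiv_eq_neg_fderiv_mul_of_integrable
      (integrable_bdd_mul_of_continuous (hDDGc _ _) (hDDGb i j) (hIP i j))
      (integrable_bdd_mul_of_continuous (hDGc _) (hDGb i) (hIdP i j))
      (integrable_bdd_mul_of_continuous (hDGc _) (hDGb i) (hIP i j))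
      (fun z _ => hDGd _ z) (fun z _ => hPd i j z)
  rw [hA]
  simp_rw [hB, hC, hDstep]
  simp [Finset.sum_neg_distrib]

end Summit.NavierStokesRegularity.NavierStokesRegularity.Theorems.StrainDoors

end
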